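import Summits.QuantumFields.YangMills.Theses.AllWindowsColdBox
import Summits.QuantumFields.YangMills.Theorems.AllWindowsColdBoxBoxHighLineLandauRung3Compositions
import Summits.QuantumFields.YangMills.Theorems.AllWindowsColdBoxBoxWindowLowSU2213

/-!
# The explicit split of ⟨stmt-QuantumFields-24336⟩ `BoxWindowHighSU2213` at θ = 1/11, BY NAME (planner ym-idea-2 g19's item split, 2026-08-30)

Bookkeeping glue for route `AllWindowsColdBox` after the planner-of-record (ym-idea-2 g19, EVENT 2026-08-30T01:42:02Z, executed 02:4xZ) split the
HIGH residual ⟨stmt-QuantumFields-24336⟩ `Theses.AllWindowsColdBox.BoxWindowHighSU2213` (θ > 1/13) into the MID item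
⟨stmt-QuantumFields-25580⟩ `Theses.AllWindowsColdBox.BoxWindowMidSU221311` (1/13 < θ ≤ 1/11, LINE-20 «landau-rung3»'s honest deliverable) and the
declared residual ⟨stmt-QuantumFields-25584⟩ `Theses.AllWindowsColdBox.BoxWindowHighSU2211` (θ > 1/11, RG/Bałaban class, NOT attacked).  This file records, as tree theorems:

* `boxWindowMidSU221311_iff` / `boxWindowHighSU2211_iff` — the two new route decls ARE the LINE-20 skeleton letters
  `BoxWindowSU22 (1/13) (1/11)` / `BoxWindowHighSU22 (1/11)` (`Iff.rfl`; the planner's probe `l27g19/split11_probe.lean`);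
* `boxWindowHighSU2213_of_mid_high11` — ⟨24336⟩ ⇐ MID ∧ High11 (both children used; `by_cases θ ≤ 1/11`);
* `boxHighWindowsSU22_of_mid_high11` — the parent crux ⟨stmt-QuantumFields-24004⟩ `BoxHighWindowsSU22` (θ > 1/16) ⇐ MID ∧ High11, the LOW window
  (1/16, 1/13] being the tree theorem ✓p748001 `BoxWindowLowSU2213_proof` (S5 `landauSecondOrder`);
* the converses `boxWindowMidSU221311_of_high13` / `boxWindowHighSU2211_of_high13` (each child is a consequence of the parent);
* `boxWindowMidSU221311_of_sizes (hK3) (hK4)` — the MID item modulo the two cut-set size statements of ✓`landauThirdOrder_of_sizes₂`, i.e.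
  ✓`LandauRung3.boxWindowMid_of_sizes` re-typed to conclude the route decl BY NAME (so the MID closer is literally
  `boxWindowMidSU221311_of_sizes <hK3> tiltCum4_cutSet_size` once the hK3 row-sum lands; hK4 = ✓p755305 `tiltCum4_cutSet_size`).

LEAD seat ym-line-sfw-p2 g79 (free hands; own crux ⟨stmt-QuantumFields-22884⟩ is line-dead and untouched by this file).
HONEST LABEL: pure bookkeeping; nothing analytic is proved here; MID is CONDITIONAL on hK3 (open at the time of writing) and hK4; the residual
`BoxWindowHighSU2211`, ⟨24336⟩, ⟨24004⟩, U5 remain OPEN; route AllWindowsColdBox DRAFT; **the Yang–Mills mass gap is NOT proved by this file;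
no summit is proved by a line.**
-/

set_option autoImplicit false

noncomputable section

open MeasureTheory Matrix
open Literature.MathematicalPhysics.QuantumFieldTheory hiding SU2 boxEdges
open Literature.MathematicalPhysics.QuantumFieldTheory.LatticeMaxwell
open Literature.MathematicalPhysics.QuantumFieldTheory.AxialGauge
open Summit.QuantumFields.YangMills.Theorems.WeakCouplingRates
open Literature.Probability.LatticeModels (Site)

namespace Summit.QuantumFields.YangMills.Theorems.AllWindowsColdBoxBoxHighLine

namespace Split11

/-- The MID route item ⟨stmt-QuantumFields-25580⟩ `BoxWindowMidSU221311` IS the LINE-20 skeleton letter `BoxWindowSU22 (1/13) (1/11)` (definitionally). -/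
theorem boxWindowMidSU221311_iff :
    Summit.QuantumFields.YangMills.Theses.AllWindowsColdBox.BoxWindowMidSU221311 ↔ BoxWindowSU22 (1 / 13) (1 / 11) :=
  Iff.rfl

/-- The declared residual ⟨stmt-QuantumFields-25584⟩ `BoxWindowHighSU2211` IS the LINE-20 skeleton letter `BoxWindowHighSU22 (1/11)` (definitionally). -/
theorem boxWindowHighSU2211_iff :
    Summit.QuantumFields.YangMills.Theses.AllWindowsColdBox.BoxWindowHighSU2211 ↔ BoxWindowHighSU22 (1 / 11) :=
  Iff.rfl

/-- **⟨stmt-QuantumFields-24336⟩ ⇐ MID ∧ High11** (the split glue; both children are used: case split on `θ ≤ 1/11`). -/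
theorem boxWindowHighSU2213_of_mid_high11
    (hmid : Summit.QuantumFields.YangMills.Theses.AllWindowsColdBox.BoxWindowMidSU221311)
    (hhi : Summit.QuantumFields.YangMills.Theses.AllWindowsColdBox.BoxWindowHighSU2211) :
    Summit.QuantumFields.YangMills.Theses.AllWindowsColdBox.BoxWindowHighSU2213 := by
  intro A θ hA hAθ h7 h13
  by_cases hθ : θ ≤ 1 / 11
  · exact hmid A θ hA hAθ h7 h13 hθ
  · exact hhi A θ hA hAθ h7 (lt_of_not_ge hθ)

/-- **The parent crux ⟨stmt-QuantumFields-24004⟩ `BoxHighWindowsSU22` (θ > 1/16) ⇐ MID ∧ High11**, the LOW window (1/16, 1/13] being the tree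
theorem ✓`BoxWindowLowSU2213_proof` (S5).  Case split `θ ≤ 1/13`, then `θ ≤ 1/11`. -/
theorem boxHighWindowsSU22_of_mid_high11
    (hmid : Summit.QuantumFields.YangMills.Theses.AllWindowsColdBox.BoxWindowMidSU221311)
    (hhi : Summit.QuantumFields.YangMills.Theses.AllWindowsColdBox.BoxWindowHighSU2211) :
    Summit.QuantumFields.YangMills.Theses.AllWindowsColdBox.BoxHighWindowsSU22 := by
  intro A θ hA hAθ h7 h16
  by_cases h13 : θ ≤ 1 / 13
  · exact BoxWindowLowSU2213_proof A θ hA hAθ h7 h16 h13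
  · by_cases h11 : θ ≤ 1 / 11
    · exact hmid A θ hA hAθ h7 (lt_of_not_ge h13) h11
    · exact hhi A θ hA hAθ h7 (lt_of_not_ge h11)

/-- Converse (informational): the parent ⟨24336⟩ gives the MID child. -/
theorem boxWindowMidSU221311_of_high13
    (h : Summit.QuantumFields.YangMills.Theses.AllWindowsColdBox.BoxWindowHighSU2213) :
    Summit.QuantumFields.YangMills.Theses.AllWindowsColdBox.BoxWindowMidSU221311 :=
  fun A θ hA hAθ h7 h13 _ => h A θ hA hAθ h7 h13

/-- Converse (informational): the parent ⟨24336⟩ gives the HIGH child. -/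
theorem boxWindowHighSU2211_of_high13
    (h : Summit.QuantumFields.YangMills.Theses.AllWindowsColdBox.BoxWindowHighSU2213) :
    Summit.QuantumFields.YangMills.Theses.AllWindowsColdBox.BoxWindowHighSU2211 :=
  fun A θ hA hAθ h7 h11 => h A θ hA hAθ h7 (lt_trans (by norm_num) h11)

/-- So, after the split, ⟨24336⟩ is EQUIVALENT to the conjunction of its two children. -/
theorem boxWindowHighSU2213_iff_mid_and_high11 :
    Summit.QuantumFields.YangMills.Theses.AllWindowsColdBox.BoxWindowHighSU2213 ↔
      (Summit.QuantumFields.YangMills.Theses.AllWindowsColdBox.BoxWindowMidSU221311 ∧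
        Summit.QuantumFields.YangMills.Theses.AllWindowsColdBox.BoxWindowHighSU2211) :=
  ⟨fun h => ⟨boxWindowMidSU221311_of_high13 h, boxWindowHighSU2211_of_high13 h⟩,
    fun h => boxWindowHighSU2213_of_mid_high11 h.1 h.2⟩

/-! ## The MID item modulo the two cut-set sizes (✓`LandauRung3.boxWindowMid_of_sizes`, re-typed to the route decl) -/

section Sizes

variable
    (hK3 : ∀ θ : ℝ, 0 < θ → θ < 1 / 10 → ∃ q : ℝ, ∃ K : ℝ → ℕ → ℝ,
      (∃ β₀ : ℝ, 1 ≤ β₀ ∧ ∀ β : ℝ, β₀ ≤ β → ∀ H : ℕ, 1 ≤ H → β ^ θ ≤ (H : ℝ) → (H : ℝ) ≤ β ^ θ + 1 →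
        ∀ D : Set (LandauFree H → E3), MeasurableSet D → D ⊆ smallField H (β ^ ((1 / 8 - θ / 4) - 1 / 2)) → (∀ a, -a ∈ D ↔ a ∈ D) →
        gaussAvg β H (fun a => 1 - D.indicator (fun _ => (1 : ℝ)) a) ≤ β ^ (-q) →
        gaussAvg β H (fun a => 1 - D.indicator (fun _ => (1 : ℝ)) a) ≤ 1 / 2 → (∀ a ∈ D, |tiltU β H a| ≤ 2) → ∀ x y : Site 4,
        |Tilt.tiltCum3 (((volume : Measure (LandauFree H → E3)).restrict D).withDensity fun a => ENNReal.ofReal (gaussWeight β H a))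
            (tiltU β H) 0 (chartPlaqCost H x 1 2) (chartPlaqCost H y 1 2)| ≤ K β H) ∧
      (∀ ε : ℝ, 0 < ε → ∃ β₀ : ℝ, 1 ≤ β₀ ∧ ∀ β : ℝ, β₀ ≤ β → ∀ H : ℕ, 1 ≤ H → (H : ℝ) ≤ β ^ θ + 1 → β ^ 2 * (H : ℝ) ^ 8 * K β H ≤ ε))
    (hK4 : ∀ θ : ℝ, 0 < θ → θ < 1 / 10 → ∃ q : ℝ, ∃ K : ℝ → ℕ → ℝ,
      (∃ β₀ : ℝ, 1 ≤ β₀ ∧ ∀ β : ℝ, β₀ ≤ β → ∀ H : ℕ, 1 ≤ H → β ^ θ ≤ (H : ℝ) → (H : ℝ) ≤ β ^ θ + 1 →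
        ∀ D : Set (LandauFree H → E3), MeasurableSet D → D ⊆ smallField H (β ^ ((1 / 8 - θ / 4) - 1 / 2)) → (∀ a, -a ∈ D ↔ a ∈ D) →
        gaussAvg β H (fun a => 1 - D.indicator (fun _ => (1 : ℝ)) a) ≤ β ^ (-q) →
        gaussAvg β H (fun a => 1 - D.indicator (fun _ => (1 : ℝ)) a) ≤ 1 / 2 → (∀ a ∈ D, |tiltU β H a| ≤ 2) → ∀ x y : Site 4,
        |Tilt.tiltCum4 (((volume : Measure (LandauFree H → E3)).restrict D).withDensity fun a => ENNReal.ofReal (gaussWeight β H a))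
            (tiltU β H) 0 (chartPlaqCost H x 1 2) (chartPlaqCost H y 1 2)| ≤ K β H) ∧
      (∀ ε : ℝ, 0 < ε → ∃ β₀ : ℝ, 1 ≤ β₀ ∧ ∀ β : ℝ, β₀ ≤ β → ∀ H : ℕ, 1 ≤ H → (H : ℝ) ≤ β ^ θ + 1 → β ^ 2 * (H : ℝ) ^ 8 * K β H ≤ ε))

include hK3 hK4

/-- ★ **The MID route item modulo the two cut-set sizes `hK3`/`hK4` of ✓`landauThirdOrder_of_sizes₂`** (= ✓`LandauRung3.boxWindowMid_of_sizes`
concluding `Theses.AllWindowsColdBox.BoxWindowMidSU221311` BY NAME).  With hK4 = ✓`tiltCum4_cutSet_size` (p755305) the MID closer is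
`boxWindowMidSU221311_of_sizes <hK3> tiltCum4_cutSet_size` the moment the hK3 row-sum lands. -/
theorem boxWindowMidSU221311_of_sizes :
    Summit.QuantumFields.YangMills.Theses.AllWindowsColdBox.BoxWindowMidSU221311 :=
  LandauRung3.boxWindowMid_of_sizes hK3 hK4

/-- ⟨stmt-QuantumFields-24336⟩ modulo the two sizes and the declared residual (route decl `BoxWindowHighSU2211` as hypothesis). -/
theorem boxWindowHighSU2213_of_sizes_high11
    (hhi : Summit.QuantumFields.YangMills.Theses.AllWindowsColdBox.BoxWindowHighSU2211) :
    Summit.QuantumFields.YangMills.Theses.AllWindowsColdBox.BoxWindowHighSU2213 :=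
  boxWindowHighSU2213_of_mid_high11 (boxWindowMidSU221311_of_sizes hK3 hK4) hhi

/-- ⟨stmt-QuantumFields-24004⟩ modulo the two sizes and the declared residual (route decl `BoxWindowHighSU2211` as hypothesis). -/
theorem boxHighWindowsSU22_of_sizes_high11
    (hhi : Summit.QuantumFields.YangMills.Theses.AllWindowsColdBox.BoxWindowHighSU2211) :
    Summit.QuantumFields.YangMills.Theses.AllWindowsColdBox.BoxHighWindowsSU22 :=
  boxHighWindowsSU22_of_mid_high11 (boxWindowMidSU221311_of_sizes hK3 hK4) hhi

end Sizes

end Split11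

end Summit.QuantumFields.YangMills.Theorems.AllWindowsColdBoxBoxHighLine

end
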